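import Mathlib.Algebra.Lie.DirectSum
import Mathlib.LinearAlgebra.Pi
import Literature.Algebra.Lie.ChevalleyEilenbergFunctoriality
import HarnessLib

/-!
# Chevalley–Eilenberg cohomology: finite direct sums and isomorphisms of coefficient modules

Topic `Algebra/Lie`; namespace `Literature.Algebra.Lie.ChevalleyEilenberg`.  Definitions with
bodies and theorems only (no named fact, no `sorry`).

For a finite family of `L`-modules `Nᵢ` and the direct sum `⨁ᵢ Nᵢ` (Mathlib's Lie module
structure `Mathlib.Algebra.Lie.DirectSum`):

* `proj i q`, `incl i q` — the cochain maps induced by the `i`-th projection / inclusion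
  (`map` of `DirectSum.lieModuleComponent` / `DirectSum.lieModuleOf`), with `proj_incl_self`,
  `proj_incl_of_ne`, `sum_incl_proj` (`Σᵢ inclᵢ ∘ projᵢ = id`), `finset_sum_apply`;
* `Subcomplex.isCochainMapTo_top_map` — a morphism of `L`-modules is a cochain map of the full
  complexes; `cohomologyProj`, `cohomologyIncl` — the induced maps on `H^q`;
* `cohomologyDirectSumEquiv L N q : H^q(L; ⨁ᵢ Nᵢ) ≃ₗ[R] Πᵢ H^q(L; Nᵢ)` — **additivity of
  cohomology in the coefficients** (the functor `V ↦ H^•(𝔤; V)` is additive; cf.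
  [cite: BorelWallach2000, I §1.2 (4)] for the stronger commutation with inductive limits), the
  form in which `H^•(𝔤, K; ⊕_π π^U ⊗ E)` decomposes over automorphic representations.

* `Subcomplex.directSumEquiv` — the same for any compatible family of subcomplexes (projections
  and inclusions cochain maps), with the instances `relCohomologyDirectSumEquiv`
  (`H^q(L, K; ⨁ᵢ Nᵢ) ≃ Πᵢ H^q(L, K; Nᵢ)`, via `Subcomplex.isCochainMapTo_rel_map`) and
  `gKCohomologyDirectSumEquiv` (`H^q(𝔤, 𝔨, K; ⨁ᵢ Nᵢ) ≃ Πᵢ H^q(𝔤, 𝔨, K; Nᵢ)` for the direct sum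
  `PairAction.directSum` of pair actions with a common `σ`, via `PairAction.act_map_of_comm`,
  `Subcomplex.isCochainMapTo_gK_map_of_comm`, `…_gK_proj`, `…_gK_incl`).

* `Subcomplex.IsCochainMapTo.cohomologyEquiv` — mutually inverse cochain maps induce inverse
  isomorphisms on cohomology; instances `cohomologyEquivOfLieModuleEquiv`,
  `relCohomologyEquivOfLieModuleEquiv`, `gKCohomologyEquivOfLieModuleEquiv` — **isomorphic
  coefficient modules have isomorphic (relative, `(𝔤, K)`-) cohomology**; `map_comp`, `map_id'`.

TODO: infinite direct sums and inductive limits [cite: BorelWallach2000, I §1.2 (4)].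

## References

* A. Borel, N. Wallach (2000), I §1.2 (4) (held) [BorelWallach2000].
-/

open Fin Function

namespace Literature.Algebra.Lie

namespace ChevalleyEilenberg

variable {R : Type*} [CommRing R] {L : Type*} [LieRing L] [LieAlgebra R L]
  {M : Type*} [AddCommGroup M] [Module R M]

/-! ### Finite direct sums of coefficient modules -/

section DirectSumCoeff

open DirectSum

variable [LieRingModule L M] [LieModule R L M]
  {ι : Type*} [DecidableEq ι] {N : ι → Type*} [∀ i, AddCommGroup (N i)]
  [∀ i, Module R (N i)] [∀ i, LieRingModule L (N i)]

/-- A morphism of `L`-modules is a cochain map between the full complexes. [folklore] -/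
theorem Subcomplex.isCochainMapTo_top_map {M' : Type*} [AddCommGroup M'] [Module R M']
    [LieRingModule L M'] [LieModule R L M'] (φ : M →ₗ⁅R,L⁆ M') :
    (Subcomplex.top R L M).IsCochainMapTo (Subcomplex.top R L M') (map L φ) :=
  ⟨fun q f => d_map φ q f, fun _ _ _ => trivial⟩

variable (L N) in
/-- Projection of cochains with values in `⨁ᵢ Nᵢ` onto the `i`-th coefficient. [folklore] -/
abbrev proj (i : ι) (q : ℕ) : Cochain R L (⨁ i, N i) q →ₗ[R] Cochain R L (N i) q :=
  map L (lieModuleComponent R ι L N i) q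

variable (L N) in
/-- Inclusion of cochains with values in `Nᵢ` into cochains with values in `⨁ᵢ Nᵢ`. [folklore] -/
abbrev incl (i : ι) (q : ℕ) : Cochain R L (N i) q →ₗ[R] Cochain R L (⨁ i, N i) q :=
  map L (lieModuleOf R ι L N i) q

/-- `projᵢ ∘ inclᵢ = id`. [folklore] -/
theorem proj_incl_self (i : ι) (q : ℕ) (f : Cochain R L (N i) q) :
    proj L N i q (incl L N i q f) = f := by
  ext v
  simp only [map_apply]
  exact component.lof_self (R := R) i (f v)

/-- `projⱼ ∘ inclᵢ = 0` for `i ≠ j`. [folklore] -/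
theorem proj_incl_of_ne {i j : ι} (h : i ≠ j) (q : ℕ) (f : Cochain R L (N i) q) :
    proj L N j q (incl L N i q f) = 0 := by
  ext v
  simp only [map_apply, AlternatingMap.zero_apply]
  change component R ι N j (lof R ι N i (f v)) = 0
  rw [component.of, dif_neg h]

omit [LieRingModule L M] [LieModule R L M] in
/-- Evaluation commutes with finite sums of cochains. [folklore] -/
theorem finset_sum_apply {κ : Type*} (s : Finset κ) {q : ℕ} (g : κ → Cochain R L M q)
    (v : Fin q → L) : (∑ k ∈ s, g k) v = ∑ k ∈ s, g k v := by
  induction s using Finset.cons_induction with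
  | empty => simp
  | cons a s ha ih => rw [Finset.sum_cons, Finset.sum_cons, AlternatingMap.add_apply, ih]

/-- `Σᵢ inclᵢ ∘ projᵢ = id` (finite index set). [folklore] -/
theorem sum_incl_proj [Fintype ι] (q : ℕ) (f : Cochain R L (⨁ i, N i) q) :
    ∑ i, incl L N i q (proj L N i q f) = f := by
  refine AlternatingMap.ext fun v => ?_
  rw [finset_sum_apply]
  simp only [map_apply]
  conv_rhs => rw [← DirectSum.sum_univ_of (f v)]
  exact Finset.sum_congr rfl fun i _ => rfl

variable [∀ i, LieModule R L (N i)]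

variable (L N) in
/-- The map `H^q(L; ⨁ᵢ Nᵢ) → H^q(L; Nᵢ)` induced by the `i`-th projection. [folklore] -/
def cohomologyProj (i : ι) (q : ℕ) :
    (Subcomplex.top R L (⨁ i, N i)).Cohomology q →ₗ[R] (Subcomplex.top R L (N i)).Cohomology q :=
  (Subcomplex.isCochainMapTo_top_map (lieModuleComponent R ι L N i)).cohomologyMap q

variable (L N) in
/-- The map `H^q(L; Nᵢ) → H^q(L; ⨁ᵢ Nᵢ)` induced by the `i`-th inclusion. [folklore] -/
def cohomologyIncl (i : ι) (q : ℕ) :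
    (Subcomplex.top R L (N i)).Cohomology q →ₗ[R] (Subcomplex.top R L (⨁ i, N i)).Cohomology q :=
  (Subcomplex.isCochainMapTo_top_map (lieModuleOf R ι L N i)).cohomologyMap q

/-- `H(projᵢ) ∘ H(inclᵢ) = id`. [folklore] -/
theorem cohomologyProj_incl_self (i : ι) (q : ℕ) (x : (Subcomplex.top R L (N i)).Cohomology q) :
    cohomologyProj L N i q (cohomologyIncl L N i q x) = x := by
  obtain ⟨z, rfl⟩ := (Subcomplex.top R L (N i)).toCohomology_surjective q x
  unfold cohomologyProj cohomologyIncl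
  rw [Subcomplex.IsCochainMapTo.cohomologyMap_toCohomology,
    Subcomplex.IsCochainMapTo.cohomologyMap_toCohomology]
  congr 1
  ext1
  rw [Subcomplex.IsCochainMapTo.coe_cocyclesMap, Subcomplex.IsCochainMapTo.coe_cocyclesMap]
  exact proj_incl_self i q z.1

/-- `H(projⱼ) ∘ H(inclᵢ) = 0` for `i ≠ j`. [folklore] -/
theorem cohomologyProj_incl_of_ne {i j : ι} (h : i ≠ j) (q : ℕ)
    (x : (Subcomplex.top R L (N i)).Cohomology q) :
    cohomologyProj L N j q (cohomologyIncl L N i q x) = 0 := by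
  obtain ⟨z, rfl⟩ := (Subcomplex.top R L (N i)).toCohomology_surjective q x
  unfold cohomologyProj cohomologyIncl
  rw [Subcomplex.IsCochainMapTo.cohomologyMap_toCohomology,
    Subcomplex.IsCochainMapTo.cohomologyMap_toCohomology, ← map_zero (Subcomplex.toCohomology _ q)]
  congr 1
  ext1
  rw [Subcomplex.IsCochainMapTo.coe_cocyclesMap, Subcomplex.IsCochainMapTo.coe_cocyclesMap]
  exact proj_incl_of_ne h q z.1

/-- `Σᵢ H(inclᵢ) ∘ H(projᵢ) = id`. [folklore] -/
theorem sum_cohomologyIncl_proj [Fintype ι] (q : ℕ)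
    (x : (Subcomplex.top R L (⨁ i, N i)).Cohomology q) :
    ∑ i, cohomologyIncl L N i q (cohomologyProj L N i q x) = x := by
  obtain ⟨z, rfl⟩ := (Subcomplex.top R L (⨁ i, N i)).toCohomology_surjective q x
  unfold cohomologyProj cohomologyIncl
  simp_rw [Subcomplex.IsCochainMapTo.cohomologyMap_toCohomology]
  rw [← map_sum]
  congr 1
  ext1
  rw [Submodule.coe_sum]
  simp_rw [Subcomplex.IsCochainMapTo.coe_cocyclesMap]
  exact sum_incl_proj q z.1

variable (L N) in
/-- **Cohomology commutes with finite direct sums of coefficients**: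
`H^q(L; ⨁ᵢ Nᵢ) ≃ Πᵢ H^q(L; Nᵢ)` (components = the maps induced by the projections; inverse =
sum of the maps induced by the inclusions). [cite: BorelWallach2000, I §1.2 (4)] -/
def cohomologyDirectSumEquiv [Fintype ι] (q : ℕ) :
    (Subcomplex.top R L (⨁ i, N i)).Cohomology q ≃ₗ[R]
      (Π i, (Subcomplex.top R L (N i)).Cohomology q) :=
  LinearEquiv.ofLinear
    (LinearMap.pi fun i => cohomologyProj L N i q)
    (∑ i, (cohomologyIncl L N i q).comp (LinearMap.proj i))
    (by
      refine LinearMap.ext fun x => funext fun j => ?_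
      simp only [LinearMap.coe_comp, Function.comp_apply, LinearMap.pi_apply,
        LinearMap.sum_apply, LinearMap.coe_proj, Function.eval, LinearMap.id_coe, id_eq, map_sum]
      rw [Finset.sum_eq_single j (fun i _ hij => cohomologyProj_incl_of_ne hij q (x i))
        (fun hj => absurd (Finset.mem_univ j) hj)]
      exact cohomologyProj_incl_self j q (x j))
    (by
      refine LinearMap.ext fun x => ?_
      simp only [LinearMap.coe_comp, Function.comp_apply, LinearMap.sum_apply,
        LinearMap.coe_proj, Function.eval, LinearMap.pi_apply, LinearMap.id_coe, id_eq]
      exact sum_cohomologyIncl_proj q x)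

/-- Components of `cohomologyDirectSumEquiv`. [folklore] -/
@[simp]
theorem cohomologyDirectSumEquiv_apply [Fintype ι] (q : ℕ)
    (x : (Subcomplex.top R L (⨁ i, N i)).Cohomology q) (i : ι) :
    cohomologyDirectSumEquiv L N q x i = cohomologyProj L N i q x := rfl

end DirectSumCoeff

/-! ### Additivity for compatible families of subcomplexes (relative and `(𝔤, K)` versions) -/

section DirectSumSubcomplex

open DirectSum

variable [LieRingModule L M] [LieModule R L M]
  {ι : Type*} [DecidableEq ι] {N : ι → Type*} [∀ i, AddCommGroup (N i)]
  [∀ i, Module R (N i)] [∀ i, LieRingModule L (N i)] [∀ i, LieModule R L (N i)]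
  {S : Subcomplex R L (⨁ i, N i)} {T : ∀ i, Subcomplex R L (N i)}

/-- **Additivity of cohomology for compatible subcomplexes.**  If `S ≤ C(L; ⨁ᵢ Nᵢ)` and
`Tᵢ ≤ C(L; Nᵢ)` are subcomplexes such that the projections and the inclusions are cochain maps
between them, then `H^q(S) ≃ Πᵢ H^q(Tᵢ)`. [cite: BorelWallach2000, I §1.2 (4)] -/
def Subcomplex.directSumEquiv [Fintype ι] (hP : ∀ i, S.IsCochainMapTo (T i) (proj L N i))
    (hI : ∀ i, (T i).IsCochainMapTo S (incl L N i)) (q : ℕ) :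
    S.Cohomology q ≃ₗ[R] (Π i, (T i).Cohomology q) :=
  LinearEquiv.ofLinear
    (LinearMap.pi fun i => (hP i).cohomologyMap q)
    (∑ i, ((hI i).cohomologyMap q).comp (LinearMap.proj i))
    (by
      refine LinearMap.ext fun x => funext fun j => ?_
      simp only [LinearMap.coe_comp, Function.comp_apply, LinearMap.pi_apply,
        LinearMap.sum_apply, LinearMap.coe_proj, Function.eval, LinearMap.id_coe, id_eq, map_sum]
      have key : ∀ i, (hP j).cohomologyMap q ((hI i).cohomologyMap q (x i)) =
          if i = j then x j else 0 := by
        intro i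
        obtain ⟨z, hz⟩ := (T i).toCohomology_surjective q (x i)
        rw [← hz, Subcomplex.IsCochainMapTo.cohomologyMap_toCohomology,
          Subcomplex.IsCochainMapTo.cohomologyMap_toCohomology]
        split_ifs with hij
        · subst hij
          rw [← hz]
          congr 1
          ext1
          rw [Subcomplex.IsCochainMapTo.coe_cocyclesMap, Subcomplex.IsCochainMapTo.coe_cocyclesMap]
          exact proj_incl_self i q z.1
        · rw [← map_zero ((T j).toCohomology q)]
          congr 1
          ext1
          rw [Subcomplex.IsCochainMapTo.coe_cocyclesMap, Subcomplex.IsCochainMapTo.coe_cocyclesMap]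
          exact proj_incl_of_ne hij q z.1
      simp_rw [key]
      rw [Finset.sum_ite_eq', if_pos (Finset.mem_univ j)])
    (by
      refine LinearMap.ext fun x => ?_
      simp only [LinearMap.coe_comp, Function.comp_apply, LinearMap.sum_apply,
        LinearMap.coe_proj, Function.eval, LinearMap.pi_apply, LinearMap.id_coe, id_eq]
      obtain ⟨z, rfl⟩ := S.toCohomology_surjective q x
      simp_rw [Subcomplex.IsCochainMapTo.cohomologyMap_toCohomology]
      rw [← map_sum]
      congr 1
      ext1
      rw [Submodule.coe_sum]
      simp_rw [Subcomplex.IsCochainMapTo.coe_cocyclesMap]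
      exact sum_incl_proj q z.1)

variable {M' : Type*} [AddCommGroup M'] [Module R M'] [LieRingModule L M'] [LieModule R L M']

/-- A morphism of `L`-modules `φ : M → M'` maps relative cochains to relative cochains (it
commutes with `i_x` and `θ_x`); hence it is a cochain map of the relative complexes.
[cite: BorelWallach2000, I §1.2] -/
theorem Subcomplex.isCochainMapTo_rel_map (K : LieSubalgebra R L) (φ : M →ₗ⁅R,L⁆ M') :
    (Subcomplex.rel R L M K).IsCochainMapTo (Subcomplex.rel R L M' K) (map L φ) where
  comm q f := d_map φ q f
  mapsTo q f hf := by
    cases q with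
    | zero =>
      rw [Subcomplex.mem_rel_zero_iff] at hf ⊢
      intro x hx
      rw [lieDer_map, hf x hx, map_zero]
    | succ q =>
      rw [Subcomplex.mem_rel_succ_iff] at hf ⊢
      intro x hx
      exact ⟨by rw [lieDer_map, (hf x hx).1, map_zero], by rw [ins_map, (hf x hx).2, map_zero]⟩

variable {Γ : Type*} [Group Γ]

omit [LieModule R L M] [LieModule R L M'] in
/-- Intertwiners commute with the actions on cochains: if two pair actions on `(L, M)` and
`(L, M')` have the same `σ` and `φ ∘ τ_g = τ'_g ∘ φ`, then `g • (φ_* f) = φ_* (g • f)`.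
[folklore] -/
theorem PairAction.act_map_of_comm (A : PairAction R L M Γ) (A' : PairAction R L M' Γ)
    (φ : M →ₗ⁅R,L⁆ M') (hσ : ∀ g, A.σ g = A'.σ g) (hφ : ∀ g m, φ (A.τ g m) = A'.τ g (φ m))
    (g : Γ) (q : ℕ) (f : Cochain R L M q) :
    A'.act g q (map L φ q f) = map L φ q (A.act g q f) := by
  ext v
  simp only [PairAction.act_apply, map_apply, hφ, hσ]

/-- An intertwiner of pair actions is a cochain map of the `(𝔤, K)`-complexes.
[cite: BorelWallach2000, I §5.1] -/
theorem Subcomplex.isCochainMapTo_gK_map_of_comm (K : LieSubalgebra R L) (A : PairAction R L M Γ)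
    (A' : PairAction R L M' Γ) (φ : M →ₗ⁅R,L⁆ M') (hσ : ∀ g, A.σ g = A'.σ g)
    (hφ : ∀ g m, φ (A.τ g m) = A'.τ g (φ m)) :
    (Subcomplex.gK R L M K A).IsCochainMapTo (Subcomplex.gK R L M' K A') (map L φ) where
  comm q f := d_map φ q f
  mapsTo q f hf := by
    rw [Subcomplex.mem_gK_iff] at hf ⊢
    refine ⟨(Subcomplex.isCochainMapTo_rel_map K φ).mapsTo q f hf.1, fun g => ?_⟩
    rw [PairAction.act_map_of_comm A A' φ hσ hφ, hf.2 g]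

/-- **The direct sum of pair actions** with a common action `σ` on `L`: `Γ` acts on `⨁ᵢ Nᵢ`
componentwise. [folklore] -/
def PairAction.directSum (σ : Γ → (L →ₗ⁅R⁆ L)) (A : ∀ i, PairAction R L (N i) Γ)
    (hσ : ∀ i g, (A i).σ g = σ g) (σ_one : σ 1 = LieHom.id)
    (σ_mul : ∀ g h, σ (g * h) = (σ g).comp (σ h)) : PairAction R L (⨁ i, N i) Γ where
  σ := σ
  τ g := lmap fun i => (A i).τ g
  σ_one := σ_one
  σ_mul := σ_mul
  τ_one := by
    ext i m j
    simp only [LinearMap.coe_comp, Function.comp_apply, lmap_lof, (A i).τ_one, LinearMap.id_comp,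
      LinearMap.id_coe, id_eq]
  τ_mul g h := by
    ext i m j
    simp only [LinearMap.coe_comp, Function.comp_apply, lmap_lof, (A i).τ_mul]
  compat g x m := by
    ext i
    rw [lmap_apply, lie_module_bracket_apply, lie_module_bracket_apply, lmap_apply,
      (A i).compat, hσ i g]

/-- The `i`-th projection intertwines the direct-sum pair action with the `i`-th one.
[folklore] -/
theorem Subcomplex.isCochainMapTo_gK_proj (K : LieSubalgebra R L) (σ : Γ → (L →ₗ⁅R⁆ L))
    (A : ∀ i, PairAction R L (N i) Γ) (hσ : ∀ i g, (A i).σ g = σ g) (σ_one : σ 1 = LieHom.id)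
    (σ_mul : ∀ g h, σ (g * h) = (σ g).comp (σ h)) (i : ι) :
    (Subcomplex.gK R L (⨁ i, N i) K (PairAction.directSum σ A hσ σ_one σ_mul)).IsCochainMapTo
      (Subcomplex.gK R L (N i) K (A i)) (proj L N i) :=
  Subcomplex.isCochainMapTo_gK_map_of_comm K _ _ _ (fun g => (hσ i g).symm)
    fun g m => lmap_apply (fun j => (A j).τ g) m i

/-- The `i`-th inclusion intertwines the `i`-th pair action with the direct-sum one. [folklore] -/
theorem Subcomplex.isCochainMapTo_gK_incl (K : LieSubalgebra R L) (σ : Γ → (L →ₗ⁅R⁆ L))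
    (A : ∀ i, PairAction R L (N i) Γ) (hσ : ∀ i g, (A i).σ g = σ g) (σ_one : σ 1 = LieHom.id)
    (σ_mul : ∀ g h, σ (g * h) = (σ g).comp (σ h)) (i : ι) :
    (Subcomplex.gK R L (N i) K (A i)).IsCochainMapTo
      (Subcomplex.gK R L (⨁ i, N i) K (PairAction.directSum σ A hσ σ_one σ_mul)) (incl L N i) :=
  Subcomplex.isCochainMapTo_gK_map_of_comm K _ _ _ (fun g => hσ i g)
    fun g m => (lmap_lof (fun j => (A j).τ g) i m).symm

/-- **Relative cohomology is additive in the coefficients**: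
`H^q(L, K_Lie; ⨁ᵢ Nᵢ) ≃ Πᵢ H^q(L, K_Lie; Nᵢ)`. [cite: BorelWallach2000, I §1.2 (4)] -/
def relCohomologyDirectSumEquiv [Fintype ι] (K : LieSubalgebra R L) (q : ℕ) :
    relCohomology R L (⨁ i, N i) K q ≃ₗ[R] (Π i, relCohomology R L (N i) K q) :=
  Subcomplex.directSumEquiv (fun _ => Subcomplex.isCochainMapTo_rel_map K _)
    (fun _ => Subcomplex.isCochainMapTo_rel_map K _) q

/-- **`(𝔤, K)`-cohomology is additive in the coefficients**:
`H^q(𝔤, 𝔨, K; ⨁ᵢ Nᵢ) ≃ Πᵢ H^q(𝔤, 𝔨, K; Nᵢ)` for componentwise `K`-actions with a common `Ad`.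
[cite: BorelWallach2000, I §5.1] -/
def gKCohomologyDirectSumEquiv [Fintype ι] (K : LieSubalgebra R L) (σ : Γ → (L →ₗ⁅R⁆ L))
    (A : ∀ i, PairAction R L (N i) Γ) (hσ : ∀ i g, (A i).σ g = σ g) (σ_one : σ 1 = LieHom.id)
    (σ_mul : ∀ g h, σ (g * h) = (σ g).comp (σ h)) (q : ℕ) :
    gKCohomology R L (⨁ i, N i) K (PairAction.directSum σ A hσ σ_one σ_mul) q ≃ₗ[R]
      (Π i, gKCohomology R L (N i) K (A i) q) :=
  Subcomplex.directSumEquiv (fun i => Subcomplex.isCochainMapTo_gK_proj K σ A hσ σ_one σ_mul i)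
    (fun i => Subcomplex.isCochainMapTo_gK_incl K σ A hσ σ_one σ_mul i) q

end DirectSumSubcomplex

section IsoCoeff

variable [LieRingModule L M]
  {M' : Type*} [AddCommGroup M'] [Module R M'] [LieRingModule L M']
  {M'' : Type*} [AddCommGroup M''] [Module R M''] [LieRingModule L M'']

/-- `map` is functorial: `(φ ∘ ψ)_* = φ_* ∘ ψ_*`. [folklore] -/
theorem map_comp (φ : M' →ₗ⁅R,L⁆ M'') (ψ : M →ₗ⁅R,L⁆ M') (q : ℕ) (f : Cochain R L M q) :
    map L (φ.comp ψ) q f = map L φ q (map L ψ q f) := rfl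

/-- `map` is functorial: `id_* = id`. [folklore] -/
theorem map_id' (q : ℕ) (f : Cochain R L M q) : map L (LieModuleHom.id : M →ₗ⁅R,L⁆ M) q f = f := by
  ext v; rfl

variable [LieModule R L M] [LieModule R L M']

/-- **Mutually inverse cochain maps induce inverse isomorphisms on cohomology.** [folklore] -/
def Subcomplex.IsCochainMapTo.cohomologyEquiv {L' : Type*} [LieRing L'] [LieAlgebra R L']
    {N : Type*} [AddCommGroup N] [Module R N] [LieRingModule L' N] [LieModule R L' N]
    {S : Subcomplex R L M} {T : Subcomplex R L' N}
    {F : (q : ℕ) → Cochain R L M q →ₗ[R] Cochain R L' N q}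
    {G : (q : ℕ) → Cochain R L' N q →ₗ[R] Cochain R L M q}
    (hF : S.IsCochainMapTo T F) (hG : T.IsCochainMapTo S G)
    (hGF : ∀ (q : ℕ) (f : Cochain R L M q), f ∈ S.carrier q → G q (F q f) = f)
    (hFG : ∀ (q : ℕ) (f : Cochain R L' N q), f ∈ T.carrier q → F q (G q f) = f) (q : ℕ) :
    S.Cohomology q ≃ₗ[R] T.Cohomology q :=
  LinearEquiv.ofLinear (hF.cohomologyMap q) (hG.cohomologyMap q)
    (by
      refine LinearMap.ext fun x => ?_
      obtain ⟨z, rfl⟩ := T.toCohomology_surjective q x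
      rw [LinearMap.comp_apply, hG.cohomologyMap_toCohomology, hF.cohomologyMap_toCohomology,
        LinearMap.id_apply]
      congr 1; ext1
      rw [hF.coe_cocyclesMap, hG.coe_cocyclesMap]
      exact hFG q z.1 ((T.mem_cocycles_iff q _).1 z.2).1)
    (by
      refine LinearMap.ext fun x => ?_
      obtain ⟨z, rfl⟩ := S.toCohomology_surjective q x
      rw [LinearMap.comp_apply, hF.cohomologyMap_toCohomology, hG.cohomologyMap_toCohomology,
        LinearMap.id_apply]
      congr 1; ext1
      rw [hG.coe_cocyclesMap, hF.coe_cocyclesMap]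
      exact hGF q z.1 ((S.mem_cocycles_iff q _).1 z.2).1)

/-- `cohomologyEquiv` is `cohomologyMap` of the forward map. [folklore] -/
@[simp]
theorem Subcomplex.IsCochainMapTo.cohomologyEquiv_apply {L' : Type*} [LieRing L'] [LieAlgebra R L']
    {N : Type*} [AddCommGroup N] [Module R N] [LieRingModule L' N] [LieModule R L' N]
    {S : Subcomplex R L M} {T : Subcomplex R L' N}
    {F : (q : ℕ) → Cochain R L M q →ₗ[R] Cochain R L' N q}
    {G : (q : ℕ) → Cochain R L' N q →ₗ[R] Cochain R L M q}
    (hF : S.IsCochainMapTo T F) (hG : T.IsCochainMapTo S G)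
    (hGF : ∀ (q : ℕ) (f : Cochain R L M q), f ∈ S.carrier q → G q (F q f) = f)
    (hFG : ∀ (q : ℕ) (f : Cochain R L' N q), f ∈ T.carrier q → F q (G q f) = f) (q : ℕ)
    (x : S.Cohomology q) : hF.cohomologyEquiv hG hGF hFG q x = hF.cohomologyMap q x := rfl

omit [LieModule R L M] [LieModule R L M'] in
/-- `e⁻¹_* ∘ e_* = id`. [folklore] -/
theorem map_symm_map (e : M ≃ₗ⁅R,L⁆ M') (q : ℕ) (f : Cochain R L M q) :
    map L (e.symm : M' →ₗ⁅R,L⁆ M) q (map L (e : M →ₗ⁅R,L⁆ M') q f) = f := by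
  ext v
  simp only [map_apply]
  exact e.symm_apply_apply (f v)

omit [LieModule R L M] [LieModule R L M'] in
/-- `e_* ∘ e⁻¹_* = id`. [folklore] -/
theorem map_map_symm (e : M ≃ₗ⁅R,L⁆ M') (q : ℕ) (f : Cochain R L M' q) :
    map L (e : M →ₗ⁅R,L⁆ M') q (map L (e.symm : M' →ₗ⁅R,L⁆ M) q f) = f := by
  ext v
  simp only [map_apply]
  exact e.apply_symm_apply (f v)

/-- **Isomorphic coefficients have isomorphic cohomology** (full complexes). [folklore] -/
def cohomologyEquivOfLieModuleEquiv (e : M ≃ₗ⁅R,L⁆ M') (q : ℕ) :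
    (Subcomplex.top R L M).Cohomology q ≃ₗ[R] (Subcomplex.top R L M').Cohomology q :=
  (Subcomplex.isCochainMapTo_top_map (e : M →ₗ⁅R,L⁆ M')).cohomologyEquiv
    (Subcomplex.isCochainMapTo_top_map (e.symm : M' →ₗ⁅R,L⁆ M))
    (fun q f _ => map_symm_map e q f) (fun q f _ => map_map_symm e q f) q

/-- Isomorphic coefficients have isomorphic relative cohomology. [cite: BorelWallach2000, I §1.2] -/
def relCohomologyEquivOfLieModuleEquiv (K : LieSubalgebra R L) (e : M ≃ₗ⁅R,L⁆ M') (q : ℕ) :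
    relCohomology R L M K q ≃ₗ[R] relCohomology R L M' K q :=
  (Subcomplex.isCochainMapTo_rel_map K (e : M →ₗ⁅R,L⁆ M')).cohomologyEquiv
    (Subcomplex.isCochainMapTo_rel_map K (e.symm : M' →ₗ⁅R,L⁆ M))
    (fun q f _ => map_symm_map e q f) (fun q f _ => map_map_symm e q f) q

variable {Γ : Type*} [Group Γ]

/-- An isomorphism of coefficients intertwining two pair actions (same `σ`) induces an
isomorphism of `(𝔤, K)`-cohomology. [cite: BorelWallach2000, I §5.1] -/
def gKCohomologyEquivOfLieModuleEquiv (K : LieSubalgebra R L) (A : PairAction R L M Γ)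
    (A' : PairAction R L M' Γ) (e : M ≃ₗ⁅R,L⁆ M') (hσ : ∀ g, A.σ g = A'.σ g)
    (he : ∀ g m, e (A.τ g m) = A'.τ g (e m)) (q : ℕ) :
    gKCohomology R L M K A q ≃ₗ[R] gKCohomology R L M' K A' q :=
  (Subcomplex.isCochainMapTo_gK_map_of_comm K A A' (e : M →ₗ⁅R,L⁆ M') hσ he).cohomologyEquiv
    (Subcomplex.isCochainMapTo_gK_map_of_comm K A' A (e.symm : M' →ₗ⁅R,L⁆ M)
      (fun g => (hσ g).symm) fun g m => by
        apply e.injective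
        change e (e.symm (A'.τ g m)) = e (A.τ g (e.symm m))
        rw [e.apply_symm_apply, he, e.apply_symm_apply])
    (fun q f _ => map_symm_map e q f) (fun q f _ => map_map_symm e q f) q

end IsoCoeff

end ChevalleyEilenberg

end Literature.Algebra.Lie
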